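import Summits.CriticalPhenomena.PercolationContinuityZ3.Theorems.PercNearOneGluingNoHeavyQuantFiveBlobs
import HarnessLib

/-!
# QUANT lane R8, T-DEC: SIX EQUAL BLOBS WITH A COMMON GATE ARE HEAVY AT THAT GATE FOR EVERY `g ∈ (0,1)` — the two band cells `1/3 < g < 2/5`
# (all floor-bound) and `2/5 ≤ g < 1/2` (one credit-bound pair) by the uniform-spreading certificate (prim-quant-census-2 gen 82, file 8)

builds on p205010 (kernel theorem, internal audit signed; external expert review pending)

Support file (`--supports stmt-CriticalPhenomena-4575`), QUANT lane census seat prim-quant-census-2 (gen 82); memo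
`run/shared/lean/prim/quant/prim-quant-census-2-g82/REFLECTION-G82.md` §3.  Theorems only, standard axioms, no sorries, no definitions.

Conjecture BLOB-AFL for six EQUAL blobs `(k,g)`: `blobLaw (replicate 6 (k,g))` is heavy at floor `g`, target `6·k·g`.  Flanks: `g ≤ 1/3`
(`heavy_blobLaw_of_mean_le_two`) and `g ≥ 1/2` (`heavy_blobLaw_replicate_of_half_le`).  Band `1/3 < g < 1/2` (`2 < s = 6g < 3`): lows `0, k`;
the zero is served by `3k..6k` at the credit gates `6g/i`; the atom `k` by `2k..6k` at the cheapest gates — ALL at the floor `g` when `g < 2/5`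
(cell A), at the credit gate `6g − 2` for `2k` and the floor elsewhere when `g ≥ 2/5` (cell B: the first kernel cell with a credit-bound pair of a
positive low atom).  Cleared loads: cell A `g³(1−g)⁵·R_A(g)`, `R_A = −90+420g−300g²−36g³−48g⁴+204g⁵−90g⁶ > 0` on `[1/3,2/5]`; cell B `g⁴(1−g)⁵·R_B(g)`,
`R_B = −30+870g−5328g²+13380g³−13566g⁴+5454g⁵−540g⁶ > 0` on `[2/5,1/2]` (both by the shift `g = g₀ + t` and monomial bounds; `R_A(2/5) = R_B(2/5)·… `:
the loads agree at the cell boundary, census value `.39`).  code: `quant/prim-quant-census-2-g82/code/poly6.py`.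
* `sixBlobs_sexticA_pos`, `sixBlobs_sexticB_pos`, `sixBlobs_loadA_le_one`, `sixBlobs_loadB_le_one`, `sum_range_seven`;
* **`heavy_blobLaw_replicate_six_cellA`** (`1/3 < g < 2/5`), **`heavy_blobLaw_replicate_six_cellB`** (`2/5 ≤ g < 1/2`),
  **`heavy_blobLaw_replicate_six`** (EVERY `0 < g < 1`), `decAtT_blobLaw_replicate_six`.
With `…QuantFiveBlobs`: BLOB-AFL for equal gates is kernel for every width ≤ 6 and every gate (widths ≤ 4 for arbitrary gates, g81).

HONEST STATUS.  `SiblingStep`, `FarTreeRow`, `GluedLemmaW`, `GluedDominatedMass` OPEN; RATE class (log\*) / honest sentence of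
`run/shared/lean/prim/quant/README.md` unchanged.  [this work].  Nothing here is cited as a published result.  The gluing rows served
[cite: KozmaNitzan2024, Conjecture 3 (p. 15)]; product measure [cite: Grimmett1999, §1.3 p. 10].
-/

noncomputable section

open scoped BigOperators

namespace Summit.CriticalPhenomena.PercolationContinuityZ3.Theorems
namespace Quant

open Finset

/-- the two-point law `{lo, hi; g}` (as in `…QuantLawDEC`) -/
local notation3 "TP[" lo ", " hi ", " g ", " h "]" =>
  (g : ℝ) * (if (h : ℕ) = (hi : ℕ) then (1 : ℝ) else 0) + (1 - (g : ℝ)) * (if (h : ℕ) = (lo : ℕ) then (1 : ℝ) else 0)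

/-- the cheapest admissible gate of the pair `{l, h}` at floor `x`, target `T`: `max(x, (T − 2l)/(h − l))` -/
local notation3 "CG[" x ", " T ", " l ", " h "]" => max (x : ℝ) (((T : ℝ) - 2 * ((l : ℕ) : ℝ)) / (((h : ℕ) : ℝ) - ((l : ℕ) : ℝ)))

/-- the Poisson-binomial point mass `P_G(j)`: the law of the blobs `(k, g)`, `g ∈ G`, at the atom `j·k` -/
local notation3 "PB[" k ", " G ", " j "]" => LawDec.blobLaw (List.map (fun g : ℝ => ((k : ℕ), g)) G) ((j : ℕ) * (k : ℕ))

namespace LawDec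

/-- seven-term range sum. [folklore] -/
theorem sum_range_seven (F : ℕ → ℝ) : ∑ i ∈ Finset.range 7, F i = F 0 + F 1 + F 2 + F 3 + F 4 + F 5 + F 6 := by
  simp only [Finset.sum_range_succ, Finset.sum_range_zero, zero_add]

/-- cell A sextic: `R_A(g) > 0` on `[1/3, 2/5]` (`R_A(1/3+t) = 1252/81 + (5704/27)t − (2782/9)t² + 60t³ + 142t⁴ + 24t⁵ − 90t⁶`). [this work] -/
theorem sixBlobs_sexticA_pos {g : ℝ} (hg1 : 1 / 3 ≤ g) (hg2 : g ≤ 2 / 5) :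
    0 < -90 + 420 * g - 300 * g ^ 2 - 36 * g ^ 3 - 48 * g ^ 4 + 204 * g ^ 5 - 90 * g ^ 6 := by
  obtain ⟨t, rfl⟩ : ∃ t, g = 1 / 3 + t := ⟨g - 1 / 3, by ring⟩
  have ht0 : 0 ≤ t := by linarith
  have ht1 : t ≤ 1 / 15 := by linarith
  have key : -90 + 420 * (1 / 3 + t) - 300 * (1 / 3 + t) ^ 2 - 36 * (1 / 3 + t) ^ 3 - 48 * (1 / 3 + t) ^ 4 + 204 * (1 / 3 + t) ^ 5
      - 90 * (1 / 3 + t) ^ 6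
      = 1252 / 81 + 5704 / 27 * t - 2782 / 9 * t ^ 2 + 60 * t ^ 3 + 142 * t ^ 4 + 24 * t ^ 5 - 90 * t ^ 6 := by ring
  rw [key]
  have h2 : t ^ 2 ≤ t * (1 / 15) := by nlinarith
  have h6 : t ^ 6 ≤ t * (1 / 15) := by
    have := pow_le_pow_left₀ ht0 ht1 5
    nlinarith
  nlinarith [pow_nonneg ht0 3, pow_nonneg ht0 4, pow_nonneg ht0 5]

/-- cell B sextic: `R_B(g) > 0` on `[2/5, 1/2]` (`R_B(2/5+t) = 88086/3125 + (138774/625)t + (24696/25)t² − (1452/5)t³ − 3954t⁴ + 4158t⁵ − 540t⁶`). [this work] -/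
theorem sixBlobs_sexticB_pos {g : ℝ} (hg1 : 2 / 5 ≤ g) (hg2 : g ≤ 1 / 2) :
    0 < -30 + 870 * g - 5328 * g ^ 2 + 13380 * g ^ 3 - 13566 * g ^ 4 + 5454 * g ^ 5 - 540 * g ^ 6 := by
  obtain ⟨t, rfl⟩ : ∃ t, g = 2 / 5 + t := ⟨g - 2 / 5, by ring⟩
  have ht0 : 0 ≤ t := by linarith
  have ht1 : t ≤ 1 / 10 := by linarith
  have key : -30 + 870 * (2 / 5 + t) - 5328 * (2 / 5 + t) ^ 2 + 13380 * (2 / 5 + t) ^ 3 - 13566 * (2 / 5 + t) ^ 4 + 5454 * (2 / 5 + t) ^ 5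
      - 540 * (2 / 5 + t) ^ 6
      = 88086 / 3125 + 138774 / 625 * t + 24696 / 25 * t ^ 2 - 1452 / 5 * t ^ 3 - 3954 * t ^ 4 + 4158 * t ^ 5 - 540 * t ^ 6 := by ring
  rw [key]
  have h3 : t ^ 3 ≤ t * (1 / 100) := by nlinarith [pow_le_pow_left₀ ht0 ht1 2]
  have h4 : t ^ 4 ≤ t * (1 / 1000) := by nlinarith [pow_le_pow_left₀ ht0 ht1 3]
  have h6 : t ^ 6 ≤ t * (1 / 100000) := by nlinarith [pow_le_pow_left₀ ht0 ht1 5]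
  nlinarith [pow_nonneg ht0 2, pow_nonneg ht0 5]

/-- cell A: the uniform-spreading load of six equal blobs in closed form is `≤ 1`. [this work] -/
theorem sixBlobs_loadA_le_one {g : ℝ} (hg1 : 1 / 3 < g) (hg2 : g < 2 / 5) :
    (1 - g) ^ 6 / (20 * g ^ 3 * (1 - g) ^ 3 * (1 - (6 * g - 0) / 3) / ((6 * g - 0) / 3) + 15 * g ^ 4 * (1 - g) ^ 2 * (1 - (6 * g - 0) / 4) / ((6 * g - 0) / 4) + 6 * g ^ 5 * (1 - g) * (1 - (6 * g - 0) / 5) / ((6 * g - 0) / 5) + g ^ 6 * (1 - (6 * g - 0) / 6) / ((6 * g - 0) / 6)) + 6 * g * (1 - g) ^ 5 / (15 * g ^ 2 * (1 - g) ^ 4 * (1 - 6 * g / 6) / (6 * g / 6) + 20 * g ^ 3 * (1 - g) ^ 3 * (1 - 6 * g / 6) / (6 * g / 6) + 15 * g ^ 4 * (1 - g) ^ 2 * (1 - 6 * g / 6) / (6 * g / 6) + 6 * g ^ 5 * (1 - g) * (1 - 6 * g / 6) / (6 * g / 6) + g ^ 6 * (1 - 6 * g / 6) / (6 * g / 6))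 ≤ 1 := by
  have hg0 : 0 < g := by linarith
  have hu : 0 < 1 - g := by linarith
  have h3 : 0 < 3 - 6 * g := by linarith
  have hq := sixBlobs_sexticA_pos hg1.le hg2.le
  have e0 : 20 * g ^ 3 * (1 - g) ^ 3 * (1 - (6 * g - 0) / 3) / ((6 * g - 0) / 3) + 15 * g ^ 4 * (1 - g) ^ 2 * (1 - (6 * g - 0) / 4) / ((6 * g - 0) / 4) + 6 * g ^ 5 * (1 - g) * (1 - (6 * g - 0) / 5) / ((6 * g - 0) / 5) + g ^ 6 * (1 - (6 * g - 0) / 6) / ((6 * g - 0) / 6)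
      = (20 * g ^ 3 * (1 - g) ^ 3 * (3 - 6 * g) + 15 * g ^ 4 * (1 - g) ^ 2 * (4 - 6 * g) + 6 * g ^ 5 * (1 - g) * (5 - 6 * g) + g ^ 6 * (6 - 6 * g)) / (6 * g) := by
    field_simp
    ring
  have e1 : 15 * g ^ 2 * (1 - g) ^ 4 * (1 - 6 * g / 6) / (6 * g / 6) + 20 * g ^ 3 * (1 - g) ^ 3 * (1 - 6 * g / 6) / (6 * g / 6) + 15 * g ^ 4 * (1 - g) ^ 2 * (1 - 6 * g / 6) / (6 * g / 6) + 6 * g ^ 5 * (1 - g) * (1 - 6 * g / 6) / (6 * g / 6) + g ^ 6 * (1 - 6 * g / 6) / (6 * g / 6)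
      = ((1 - g) * (15 * g ^ 2 * (1 - g) ^ 4 + 20 * g ^ 3 * (1 - g) ^ 3 + 15 * g ^ 4 * (1 - g) ^ 2 + 6 * g ^ 5 * (1 - g) + g ^ 6)) / g := by
    field_simp
  have hN0 : 0 < (20 * g ^ 3 * (1 - g) ^ 3 * (3 - 6 * g) + 15 * g ^ 4 * (1 - g) ^ 2 * (4 - 6 * g) + 6 * g ^ 5 * (1 - g) * (5 - 6 * g) + g ^ 6 * (6 - 6 * g)) := by
    have t4 : 0 < 4 - 6 * g := by linarith
    have t5 : 0 < 5 - 6 * g := by linarith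
    have t6 : 0 < 6 - 6 * g := by linarith
    positivity
  have hN1 : 0 < (1 - g) * (15 * g ^ 2 * (1 - g) ^ 4 + 20 * g ^ 3 * (1 - g) ^ 3 + 15 * g ^ 4 * (1 - g) ^ 2 + 6 * g ^ 5 * (1 - g) + g ^ 6) := by positivity
  rw [e0, e1, div_div_eq_mul_div, div_div_eq_mul_div, div_add_div _ _ hN0.ne' hN1.ne', div_le_one (mul_pos hN0 hN1), ← sub_nonneg]
  have key : (20 * g ^ 3 * (1 - g) ^ 3 * (3 - 6 * g) + 15 * g ^ 4 * (1 - g) ^ 2 * (4 - 6 * g) + 6 * g ^ 5 * (1 - g) * (5 - 6 * g) + g ^ 6 * (6 - 6 * g)) * ((1 - g) * (15 * g ^ 2 * (1 - g) ^ 4 + 20 * g ^ 3 * (1 - g) ^ 3 + 15 * g ^ 4 * (1 - g) ^ 2 + 6 * g ^ 5 * (1 - g) + g ^ 6)) - ((1 - g) ^ 6 * (6 * g) * ((1 - g) * (15 * g ^ 2 * (1 - g) ^ 4 + 20 * g ^ 3 * (1 - g) ^ 3 + 15 * g ^ 4 * (1 - g) ^ 2 + 6 * g ^ 5 * (1 -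 g) + g ^ 6)) + (20 * g ^ 3 * (1 - g) ^ 3 * (3 - 6 * g) + 15 * g ^ 4 * (1 - g) ^ 2 * (4 - 6 * g) + 6 * g ^ 5 * (1 - g) * (5 - 6 * g) + g ^ 6 * (6 - 6 * g)) * (6 * g * (1 - g) ^ 5 * g)) = g ^ 3 * (1 - g) ^ 5 * (-90 + 420 * g - 300 * g ^ 2 - 36 * g ^ 3 - 48 * g ^ 4 + 204 * g ^ 5 - 90 * g ^ 6) := by ring
  rw [key]
  exact mul_nonneg (mul_nonneg (pow_nonneg hg0.le _) (pow_nonneg hu.le _)) hq.le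

/-- cell B: the uniform-spreading load of six equal blobs in closed form is `≤ 1`. [this work] -/
theorem sixBlobs_loadB_le_one {g : ℝ} (hg1 : 2 / 5 ≤ g) (hg2 : g < 1 / 2) :
    (1 - g) ^ 6 / (20 * g ^ 3 * (1 - g) ^ 3 * (1 - (6 * g - 0) / 3) / ((6 * g - 0) / 3) + 15 * g ^ 4 * (1 - g) ^ 2 * (1 - (6 * g - 0) / 4) / ((6 * g - 0) / 4) + 6 * g ^ 5 * (1 - g) * (1 - (6 * g - 0) / 5) / ((6 * g - 0) / 5) + g ^ 6 * (1 - (6 * g - 0) / 6) / ((6 * g - 0) / 6)) + 6 * g * (1 - g) ^ 5 / (15 * g ^ 2 * (1 - g) ^ 4 * (1 - (6 * g - 2) / 1) / ((6 * g - 2) / 1) + 20 * g ^ 3 * (1 - g) ^ 3 * (1 - 6 * g / 6) / (6 * g / 6) + 15 * g ^ 4 * (1 - g) ^ 2 * (1 - 6 * g / 6) / (6 * g / 6) + 6 * g ^ 5 * (1 - g) * (1 - 6 * g / 6) / (6 * g / 6) + g ^ 6 * (1 - 6 * g / 6) / (6 * g / 6)) ≤ 1 := by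
  have hg0 : 0 < g := by linarith
  have hu : 0 < 1 - g := by linarith
  have h3 : 0 < 3 - 6 * g := by linarith
  have hq := sixBlobs_sexticB_pos hg1 hg2.le
  have e0 : 20 * g ^ 3 * (1 - g) ^ 3 * (1 - (6 * g - 0) / 3) / ((6 * g - 0) / 3) + 15 * g ^ 4 * (1 - g) ^ 2 * (1 - (6 * g - 0) / 4) / ((6 * g - 0) / 4) + 6 * g ^ 5 * (1 - g) * (1 - (6 * g - 0) / 5) / ((6 * g - 0) / 5) + g ^ 6 * (1 - (6 * g - 0) / 6) / ((6 * g - 0) / 6)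
      = (20 * g ^ 3 * (1 - g) ^ 3 * (3 - 6 * g) + 15 * g ^ 4 * (1 - g) ^ 2 * (4 - 6 * g) + 6 * g ^ 5 * (1 - g) * (5 - 6 * g) + g ^ 6 * (6 - 6 * g)) / (6 * g) := by
    field_simp
    ring
  have hs2 : 0 < 6 * g - 2 := by linarith
  have hs2' : 6 * g - 2 * 1 ≠ 0 := by linarith
  have hs2'' : 6 * g - 2 ≠ 0 := by linarith
  have hs2c : g * 6 - 2 ≠ 0 := by linarith
  have e1 : 15 * g ^ 2 * (1 - g) ^ 4 * (1 - (6 * g - 2) / 1) / ((6 * g - 2) / 1) + 20 * g ^ 3 * (1 - g) ^ 3 * (1 - 6 * g / 6) / (6 * g / 6) + 15 * g ^ 4 * (1 - g) ^ 2 * (1 - 6 * g / 6) / (6 * g / 6) + 6 * g ^ 5 * (1 - g) * (1 - 6 * g / 6) / (6 * g / 6) + g ^ 6 * (1 - 6 * g / 6) / (6 * g / 6)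
      = (g * (15 * g ^ 2 * (1 - g) ^ 4) * (3 - 6 * g) + (6 * g - 2) * (1 - g) * (20 * g ^ 3 * (1 - g) ^ 3 + 15 * g ^ 4 * (1 - g) ^ 2 + 6 * g ^ 5 * (1 - g) + g ^ 6)) / (g * (6 * g - 2)) := by
    field_simp
    ring
  have hN0 : 0 < (20 * g ^ 3 * (1 - g) ^ 3 * (3 - 6 * g) + 15 * g ^ 4 * (1 - g) ^ 2 * (4 - 6 * g) + 6 * g ^ 5 * (1 - g) * (5 - 6 * g) + g ^ 6 * (6 - 6 * g)) := by
    have t4 : 0 < 4 - 6 * g := by linarith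
    have t5 : 0 < 5 - 6 * g := by linarith
    have t6 : 0 < 6 - 6 * g := by linarith
    positivity
  have hN1 : 0 < (g * (15 * g ^ 2 * (1 - g) ^ 4) * (3 - 6 * g) + (6 * g - 2) * (1 - g) * (20 * g ^ 3 * (1 - g) ^ 3 + 15 * g ^ 4 * (1 - g) ^ 2 + 6 * g ^ 5 * (1 - g) + g ^ 6)) := by positivity
  rw [e0, e1, div_div_eq_mul_div, div_div_eq_mul_div, div_add_div _ _ hN0.ne' hN1.ne', div_le_one (mul_pos hN0 hN1), ← sub_nonneg]
  have key : (20 * g ^ 3 * (1 - g) ^ 3 * (3 - 6 * g) + 15 * g ^ 4 * (1 - g) ^ 2 * (4 - 6 * g) + 6 * g ^ 5 * (1 - g) * (5 - 6 * g) + g ^ 6 * (6 - 6 * g)) * ((g * (15 * g ^ 2 * (1 - g) ^ 4) * (3 - 6 * g) + (6 * g - 2) * (1 - g) * (20 * g ^ 3 * (1 - g) ^ 3 + 15 * g ^ 4 * (1 - g) ^ 2 + 6 * g ^ 5 * (1 - g) + g ^ 6))) - ((1 - g) ^ 6 * (6 * g) * ((g * (15 * g ^ 2 * (1 - g) ^ 4)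 * (3 - 6 * g) + (6 * g - 2) * (1 - g) * (20 * g ^ 3 * (1 - g) ^ 3 + 15 * g ^ 4 * (1 - g) ^ 2 + 6 * g ^ 5 * (1 - g) + g ^ 6))) + (20 * g ^ 3 * (1 - g) ^ 3 * (3 - 6 * g) + 15 * g ^ 4 * (1 - g) ^ 2 * (4 - 6 * g) + 6 * g ^ 5 * (1 - g) * (5 - 6 * g) + g ^ 6 * (6 - 6 * g)) * (6 * g * (1 - g) ^ 5 * (g * (6 * g - 2)))) = g ^ 4 * (1 - g) ^ 5 * (-30 + 870 * g - 5328 * g ^ 2 + 13380 * g ^ 3 - 13566 * g ^ 4 + 5454 * g ^ 5 - 540 * g ^ 6) := by ring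
  rw [key]
  exact mul_nonneg (mul_nonneg (pow_nonneg hg0.le _) (pow_nonneg hu.le _)) hq.le

/-- **SIX EQUAL BLOBS, CELL A**: `blobLaw (replicate 6 (k,g))` is heavy at floor `g`, target `6·k·g`. [this work] -/
theorem heavy_blobLaw_replicate_six_cellA (k : ℕ) (hk : 0 < k) {g : ℝ} (hg1 : 1 / 3 < g) (hg2 : g < 2 / 5) :
    ∃ (ι : Type) (_ : Fintype ι) (lam γ : ι → ℝ) (lo hi : ι → ℕ),
      (∀ i, 0 ≤ lam i) ∧ (∑ i, lam i = 1) ∧ (∀ i, 0 ≤ γ i ∧ γ i ≤ 1) ∧ (∀ i, lo i ≤ hi i) ∧ (∀ i, hi i ≤ 6 * k) ∧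
      (∀ h, blobLaw (List.replicate 6 (k, g)) h = ∑ i, lam i * TP[lo i, hi i, γ i, h]) ∧
      (∀ i, 0 < lam i → g ≤ γ i ∧ (6 : ℝ) * k * g ≤ 2 * (lo i : ℝ) + ((hi i : ℝ) - lo i) * γ i) := by
  have hG : ∀ x ∈ List.replicate 6 g, 0 < x ∧ x < 1 := fun x hx => by
    rw [List.eq_of_mem_replicate hx]; exact ⟨by linarith, by linarith⟩
  have hS : (List.replicate 6 g).sum = 6 * g := by
    simp only [List.replicate, List.sum_cons, List.sum_nil]; ring
  have hL : (List.replicate 6 g).length = 6 := by simp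
  have hM : List.map (fun g : ℝ => (k, g)) (List.replicate 6 g) = List.replicate 6 (k, g) := by simp
  have key := heavy_blobLaw_of_unitLoad_le_one k hk (List.replicate 6 g) hG (by rw [hL]; norm_num) ?_
  · rw [hS, hL, hM] at key
    have e1 : (6 : ℝ) * g / ((6 : ℕ) : ℝ) = g := by push_cast; ring
    have e2 : (k : ℝ) * (6 * g) = (6 : ℝ) * k * g := by ring
    rw [e1, e2] at key
    exact key
  · rw [hS, hL, hM, sum_range_seven]
    push_cast
    rw [if_pos (by linarith : (2 : ℝ) * 0 < 6 * g), if_pos (by linarith : (2 : ℝ) * 1 < 6 * g),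
      if_neg (by linarith : ¬ (2 : ℝ) * 2 < 6 * g), if_neg (by linarith : ¬ (2 : ℝ) * 3 < 6 * g),
      if_neg (by linarith : ¬ (2 : ℝ) * 4 < 6 * g), if_neg (by linarith : ¬ (2 : ℝ) * 5 < 6 * g),
      if_neg (by linarith : ¬ (2 : ℝ) * 6 < 6 * g)]
    simp only [add_zero]
    rw [sum_range_seven, sum_range_seven]
    push_cast
    rw [if_neg (by linarith : ¬ (6 : ℝ) * g - 0 < 0), if_neg (by linarith : ¬ (6 : ℝ) * g - 0 < 1),
      if_neg (by linarith : ¬ (6 : ℝ) * g - 0 < 2), if_pos (by linarith : (6 : ℝ) * g - 0 < 3),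
      if_pos (by linarith : (6 : ℝ) * g - 0 < 4), if_pos (by linarith : (6 : ℝ) * g - 0 < 5), if_pos (by linarith : (6 : ℝ) * g - 0 < 6),
      if_neg (by linarith : ¬ (6 : ℝ) * g - 1 < 0), if_neg (by linarith : ¬ (6 : ℝ) * g - 1 < 1),
      if_pos (by linarith : (6 : ℝ) * g - 1 < 2), if_pos (by linarith : (6 : ℝ) * g - 1 < 3),
      if_pos (by linarith : (6 : ℝ) * g - 1 < 4), if_pos (by linarith : (6 : ℝ) * g - 1 < 5), if_pos (by linarith : (6 : ℝ) * g - 1 < 6)]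
    simp only [zero_add]
    rw [max_eq_right (show (6 : ℝ) * g / 6 ≤ (6 * g - 2 * 0) / (3 - 0) by rw [div_le_div_iff₀ (by norm_num) (by norm_num)]; nlinarith)]
    rw [max_eq_right (show (6 : ℝ) * g / 6 ≤ (6 * g - 2 * 0) / (4 - 0) by rw [div_le_div_iff₀ (by norm_num) (by norm_num)]; nlinarith)]
    rw [max_eq_right (show (6 : ℝ) * g / 6 ≤ (6 * g - 2 * 0) / (5 - 0) by rw [div_le_div_iff₀ (by norm_num) (by norm_num)]; nlinarith)]
    rw [max_eq_right (show (6 : ℝ) * g / 6 ≤ (6 * g - 2 * 0) / (6 - 0) by rw [div_le_div_iff₀ (by norm_num) (by norm_num)]; nlinarith)]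
    rw [max_eq_left (show ((6 : ℝ) * g - 2 * 1) / (2 - 1) ≤ 6 * g / 6 by rw [div_le_div_iff₀ (by norm_num) (by norm_num)]; nlinarith)]
    rw [max_eq_left (show ((6 : ℝ) * g - 2 * 1) / (3 - 1) ≤ 6 * g / 6 by rw [div_le_div_iff₀ (by norm_num) (by norm_num)]; nlinarith)]
    rw [max_eq_left (show ((6 : ℝ) * g - 2 * 1) / (4 - 1) ≤ 6 * g / 6 by rw [div_le_div_iff₀ (by norm_num) (by norm_num)]; nlinarith)]
    rw [max_eq_left (show ((6 : ℝ) * g - 2 * 1) / (5 - 1) ≤ 6 * g / 6 by rw [div_le_div_iff₀ (by norm_num) (by norm_num)]; nlinarith)]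
    rw [max_eq_left (show ((6 : ℝ) * g - 2 * 1) / (6 - 1) ≤ 6 * g / 6 by rw [div_le_div_iff₀ (by norm_num) (by norm_num)]; nlinarith)]
    have hb : ∀ j : ℕ, blobLaw [((k : ℕ), g), (k, g), (k, g), (k, g), (k, g), (k, g)] (j * k)
        = (Nat.choose 6 j : ℝ) * g ^ j * (1 - g) ^ (6 - j) := fun j => blobLaw_replicate k hk g 6 j
    rw [hb 0, hb 1, hb 2, hb 3, hb 4, hb 5, hb 6]
    rw [show (Nat.choose 6 0 : ℝ) = 1 by norm_num [Nat.choose], show (Nat.choose 6 1 : ℝ) = 6 by norm_num [Nat.choose],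
      show (Nat.choose 6 2 : ℝ) = 15 by norm_num [Nat.choose], show (Nat.choose 6 3 : ℝ) = 20 by norm_num [Nat.choose],
      show (Nat.choose 6 4 : ℝ) = 15 by norm_num [Nat.choose], show (Nat.choose 6 5 : ℝ) = 6 by norm_num [Nat.choose],
      show (Nat.choose 6 6 : ℝ) = 1 by norm_num [Nat.choose]]
    norm_num only [pow_zero, pow_one, mul_one, one_mul, Nat.sub_self, Nat.sub_zero]
    exact sixBlobs_loadA_le_one hg1 hg2

/-- **SIX EQUAL BLOBS, CELL B**: `blobLaw (replicate 6 (k,g))` is heavy at floor `g`, target `6·k·g`. [this work] -/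
theorem heavy_blobLaw_replicate_six_cellB (k : ℕ) (hk : 0 < k) {g : ℝ} (hg1 : 2 / 5 ≤ g) (hg2 : g < 1 / 2) :
    ∃ (ι : Type) (_ : Fintype ι) (lam γ : ι → ℝ) (lo hi : ι → ℕ),
      (∀ i, 0 ≤ lam i) ∧ (∑ i, lam i = 1) ∧ (∀ i, 0 ≤ γ i ∧ γ i ≤ 1) ∧ (∀ i, lo i ≤ hi i) ∧ (∀ i, hi i ≤ 6 * k) ∧
      (∀ h, blobLaw (List.replicate 6 (k, g)) h = ∑ i, lam i * TP[lo i, hi i, γ i, h]) ∧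
      (∀ i, 0 < lam i → g ≤ γ i ∧ (6 : ℝ) * k * g ≤ 2 * (lo i : ℝ) + ((hi i : ℝ) - lo i) * γ i) := by
  have hG : ∀ x ∈ List.replicate 6 g, 0 < x ∧ x < 1 := fun x hx => by
    rw [List.eq_of_mem_replicate hx]; exact ⟨by linarith, by linarith⟩
  have hS : (List.replicate 6 g).sum = 6 * g := by
    simp only [List.replicate, List.sum_cons, List.sum_nil]; ring
  have hL : (List.replicate 6 g).length = 6 := by simp
  have hM : List.map (fun g : ℝ => (k, g)) (List.replicate 6 g) = List.replicate 6 (k, g) := by simp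
  have key := heavy_blobLaw_of_unitLoad_le_one k hk (List.replicate 6 g) hG (by rw [hL]; norm_num) ?_
  · rw [hS, hL, hM] at key
    have e1 : (6 : ℝ) * g / ((6 : ℕ) : ℝ) = g := by push_cast; ring
    have e2 : (k : ℝ) * (6 * g) = (6 : ℝ) * k * g := by ring
    rw [e1, e2] at key
    exact key
  · rw [hS, hL, hM, sum_range_seven]
    push_cast
    rw [if_pos (by linarith : (2 : ℝ) * 0 < 6 * g), if_pos (by linarith : (2 : ℝ) * 1 < 6 * g),
      if_neg (by linarith : ¬ (2 : ℝ) * 2 < 6 * g), if_neg (by linarith : ¬ (2 : ℝ) * 3 < 6 * g),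
      if_neg (by linarith : ¬ (2 : ℝ) * 4 < 6 * g), if_neg (by linarith : ¬ (2 : ℝ) * 5 < 6 * g),
      if_neg (by linarith : ¬ (2 : ℝ) * 6 < 6 * g)]
    simp only [add_zero]
    rw [sum_range_seven, sum_range_seven]
    push_cast
    rw [if_neg (by linarith : ¬ (6 : ℝ) * g - 0 < 0), if_neg (by linarith : ¬ (6 : ℝ) * g - 0 < 1),
      if_neg (by linarith : ¬ (6 : ℝ) * g - 0 < 2), if_pos (by linarith : (6 : ℝ) * g - 0 < 3),
      if_pos (by linarith : (6 : ℝ) * g - 0 < 4), if_pos (by linarith : (6 : ℝ) * g - 0 < 5), if_pos (by linarith : (6 : ℝ) * g - 0 < 6),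
      if_neg (by linarith : ¬ (6 : ℝ) * g - 1 < 0), if_neg (by linarith : ¬ (6 : ℝ) * g - 1 < 1),
      if_pos (by linarith : (6 : ℝ) * g - 1 < 2), if_pos (by linarith : (6 : ℝ) * g - 1 < 3),
      if_pos (by linarith : (6 : ℝ) * g - 1 < 4), if_pos (by linarith : (6 : ℝ) * g - 1 < 5), if_pos (by linarith : (6 : ℝ) * g - 1 < 6)]
    simp only [zero_add]
    rw [max_eq_right (show (6 : ℝ) * g / 6 ≤ (6 * g - 2 * 0) / (3 - 0) by rw [div_le_div_iff₀ (by norm_num) (by norm_num)]; nlinarith)]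
    rw [max_eq_right (show (6 : ℝ) * g / 6 ≤ (6 * g - 2 * 0) / (4 - 0) by rw [div_le_div_iff₀ (by norm_num) (by norm_num)]; nlinarith)]
    rw [max_eq_right (show (6 : ℝ) * g / 6 ≤ (6 * g - 2 * 0) / (5 - 0) by rw [div_le_div_iff₀ (by norm_num) (by norm_num)]; nlinarith)]
    rw [max_eq_right (show (6 : ℝ) * g / 6 ≤ (6 * g - 2 * 0) / (6 - 0) by rw [div_le_div_iff₀ (by norm_num) (by norm_num)]; nlinarith)]
    rw [max_eq_right (show (6 : ℝ) * g / 6 ≤ (6 * g - 2 * 1) / (2 - 1) by rw [div_le_div_iff₀ (by norm_num) (by norm_num)]; nlinarith)]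
    rw [max_eq_left (show ((6 : ℝ) * g - 2 * 1) / (3 - 1) ≤ 6 * g / 6 by rw [div_le_div_iff₀ (by norm_num) (by norm_num)]; nlinarith)]
    rw [max_eq_left (show ((6 : ℝ) * g - 2 * 1) / (4 - 1) ≤ 6 * g / 6 by rw [div_le_div_iff₀ (by norm_num) (by norm_num)]; nlinarith)]
    rw [max_eq_left (show ((6 : ℝ) * g - 2 * 1) / (5 - 1) ≤ 6 * g / 6 by rw [div_le_div_iff₀ (by norm_num) (by norm_num)]; nlinarith)]
    rw [max_eq_left (show ((6 : ℝ) * g - 2 * 1) / (6 - 1) ≤ 6 * g / 6 by rw [div_le_div_iff₀ (by norm_num) (by norm_num)]; nlinarith)]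
    have hb : ∀ j : ℕ, blobLaw [((k : ℕ), g), (k, g), (k, g), (k, g), (k, g), (k, g)] (j * k)
        = (Nat.choose 6 j : ℝ) * g ^ j * (1 - g) ^ (6 - j) := fun j => blobLaw_replicate k hk g 6 j
    rw [hb 0, hb 1, hb 2, hb 3, hb 4, hb 5, hb 6]
    rw [show (Nat.choose 6 0 : ℝ) = 1 by norm_num [Nat.choose], show (Nat.choose 6 1 : ℝ) = 6 by norm_num [Nat.choose],
      show (Nat.choose 6 2 : ℝ) = 15 by norm_num [Nat.choose], show (Nat.choose 6 3 : ℝ) = 20 by norm_num [Nat.choose],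
      show (Nat.choose 6 4 : ℝ) = 15 by norm_num [Nat.choose], show (Nat.choose 6 5 : ℝ) = 6 by norm_num [Nat.choose],
      show (Nat.choose 6 6 : ℝ) = 1 by norm_num [Nat.choose]]
    norm_num only [pow_zero, pow_one, mul_one, one_mul, Nat.sub_self, Nat.sub_zero]
    exact sixBlobs_loadB_le_one hg1 hg2

/-- **SIX EQUAL BLOBS WITH A COMMON GATE `g ∈ (0,1)` ARE HEAVY AT FLOOR `g`, TARGET `6·k·g` — EVERY `g`, EVERY `k ≥ 1`** (conjecture BLOB-AFL at
width 6 for equal gates): zero-only-low flank `g ≤ 1/3`, cells A and B, reflection flank `g ≥ 1/2`. [this work] -/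
theorem heavy_blobLaw_replicate_six (k : ℕ) (hk : 0 < k) {g : ℝ} (hg0 : 0 < g) (hg1 : g < 1) :
    ∃ (ι : Type) (_ : Fintype ι) (lam γ : ι → ℝ) (lo hi : ι → ℕ),
      (∀ i, 0 ≤ lam i) ∧ (∑ i, lam i = 1) ∧ (∀ i, 0 ≤ γ i ∧ γ i ≤ 1) ∧ (∀ i, lo i ≤ hi i) ∧ (∀ i, hi i ≤ 6 * k) ∧
      (∀ h, blobLaw (List.replicate 6 (k, g)) h = ∑ i, lam i * TP[lo i, hi i, γ i, h]) ∧
      (∀ i, 0 < lam i → g ≤ γ i ∧ (6 : ℝ) * k * g ≤ 2 * (lo i : ℝ) + ((hi i : ℝ) - lo i) * γ i) := by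
  have hk' : (0 : ℝ) < k := by exact_mod_cast hk
  rcases le_or_gt g (1 / 3) with hle | hlt
  · have hl : ∀ p ∈ List.replicate 6 (k, g), p.1 = k ∧ 0 ≤ p.2 ∧ p.2 ≤ 1 := fun p hp => by
      rw [List.eq_of_mem_replicate hp]; exact ⟨rfl, hg0.le, hg1.le⟩
    have htop : blobTop (List.replicate 6 (k, g)) = 6 * k := blobTop_replicate 6 k g
    have hmean : blobMean (List.replicate 6 (k, g)) = (6 : ℝ) * k * g := by
      rw [blobMean_replicate]; push_cast; ring
    have hm0 : 0 < blobMean (List.replicate 6 (k, g)) := by rw [hmean]; positivity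
    have hm2 : blobMean (List.replicate 6 (k, g)) ≤ 2 * k := by rw [hmean]; nlinarith
    have key := heavy_blobLaw_of_mean_le_two k _ hl hm0 hm2
    rw [hmean, htop] at key
    have e : (6 : ℝ) * k * g / ((6 * k : ℕ) : ℝ) = g := by push_cast; field_simp
    rw [e] at key
    exact key
  · rcases lt_or_ge g (2 / 5) with hA | hB
    · exact heavy_blobLaw_replicate_six_cellA k hk hlt hA
    · rcases lt_or_ge g (1 / 2) with hB2 | hge
      · exact heavy_blobLaw_replicate_six_cellB k hk hB hB2
      · have key := heavy_blobLaw_replicate_of_half_le 6 k hge hg1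
        push_cast at key
        exact key

/-- **hence DEC at every layer** for six equal blobs with any common gate `g ∈ (0,1)`. [this work] -/
theorem decAtT_blobLaw_replicate_six (k : ℕ) (hk : 0 < k) {g : ℝ} (hg0 : 0 < g) (hg1 : g < 1) (j : ℕ) :
    DECAtT g ((6 : ℝ) * k * g) j (6 * k) (blobLaw (List.replicate 6 (k, g))) :=
  decAtT_of_heavy _ _ _ _ (heavy_blobLaw_replicate_six k hk hg0 hg1) j

end LawDec
end Quant
end Summit.CriticalPhenomena.PercolationContinuityZ3.Theorems
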